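/-
Copyright: rh-split cell (screw, prover seat l19) gen 0, 2026-08-27.  Splitting search over kernel-typed
RH-equivalences.  A splitting `A ∧ B ⟹ RH` is CONDITIONAL bookkeeping unless `A` and `B` are both
proved; nothing here bears on the truth of RH.
-/
import Summits.RiemannHypothesis.RiemannHypothesis.Theorems.Splittings.ScrewBorelFluxB
import Summits.RiemannHypothesis.RiemannHypothesis.Theorems.Splittings.ScrewLatticeContinuationB
import Mathlib.Analysis.SpecificLimits.Basic
import HarnessLib

/-!
# Route X-13 `ScrewLasso` — LASSO FLUX (item `LassoFlux`, RH-free): the total aliased charge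
vanishes when origin-centred wall-free circles of radii `→ 1` exist at the step `h`

Objects of `ScrewLatticeContinuation` (row X-9) and `ScrewBorelFlux` (row X-10): step `h > 0`,
multipliers `u_ρ = e^{(ρ-1/2)h}` (`mult`), coefficients `c_ρ` (`coeff`; `Re c_ρ < 0`, `∑ ‖c_ρ‖ < ∞`),
the lattice generating function `latticeGF h` (holomorphic on `𝔻` under `CEIL(h)`, equal to the Borel
series near `0`), the aliased pole field `aliasedPoleSet h` with closure `T_h`, `Ω₀` = the component of
`0` in `𝔻 ∖ T_h`, and the disc charge `discWeight c u p R` (`c/2 · q` for each pole `q ∈ {u⁻¹, u}` with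
`‖q - p‖ < R`).

* §1 (ζ-free) **flux identity for every circle in the disc** (`tsum_discWeight_eq_zero_of_lt_one`): the
  tree's `ScrewBorelFlux.tsum_discWeight_eq_zero` with the radius cap `R ≤ (1 - ‖p‖)/2` replaced by
  `‖p‖ + R < 1` (the separation `δ ≤ 1 - (‖p‖ + R)` is re-derived per radius; proof otherwise verbatim).
* §2 (ζ-free) **radius → 1⁻** (`tsum_discWeight_zero_one_eq_zero`): if the charge on `ball 0 r`
  vanishes for radii `r → 1⁻`, the charge on the unit disc vanishes (each term is eventually constant;
  Tannery with the bound `‖c i‖`).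
* §3 (ζ-side) **LASSO FLUX** (`lassoFlux_of_latticeCeiling`): for `h > 0` with `CEIL(h)`, if for every
  `δ > 0` some circle `|z| = r`, `r ∈ (1 - δ, 1)`, lies in `Ω₀`, then
  `∑_ρ discWeight (c_ρ) (u_ρ) 0 1 = 0` — the statement of `Theses.ScrewLasso.LassoFlux` (closing file
  `ScrewLassoFlux`).

RH is not proved by this: `LassoFlux` is one RH-free leg of the CONDITIONAL splitting X-13
`LassoFlux ∧ ChargeContinuity ∧ LassoFine ∧ CeilAll ⟹ RH`.
No `sorry`, no new axioms, no instances, no notation.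
-/

set_option linter.dupNamespace false

namespace Summit.RiemannHypothesis.RiemannHypothesis.Theorems.Splittings.ScrewLassoFlux

open Complex Filter Topology Set Metric MeasureTheory
open scoped Real
open Literature.NumberTheory.LFunctions
open ZetaZeros.riemannZetaNontrivialZeros
open Summit.RiemannHypothesis.RiemannHypothesis.Theorems.Splittings
open Summit.RiemannHypothesis.RiemannHypothesis.Theorems.Splittings.ScrewBorel
open Summit.RiemannHypothesis.RiemannHypothesis.Theorems.Splittings.ScrewBorelFlux
open Summit.RiemannHypothesis.RiemannHypothesis.Theorems.Splittings.ScrewLatticeContinuation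

/-! ## 1. Flux identity for every circle inside the disc (ζ-free) -/

/-- **Flux identity, any radius (ζ-free).**  `F` holomorphic on `𝔻` and equal to the Borel series on
`ball 0 r₀`; a circle `sphere p R` (`R > 0`, `‖p‖ + R < 1`) contained in a preconnected `V ∋ 0` inside
`𝔻 ∖ closure (poleSet u)` encloses total charge zero: `∑' i, discWeight (c i) (u i) p R = 0`.
(`ScrewBorelFlux.tsum_discWeight_eq_zero` without the cap `R ≤ (1 - ‖p‖)/2`.) -/
theorem tsum_discWeight_eq_zero_of_lt_one {ι : Type*} [Countable ι] {c u : ι → ℂ}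
    (hc : Summable fun i ↦ ‖c i‖) (hu : ∀ i, u i ≠ 0) {F : ℂ → ℂ}
    (hF : DifferentiableOn ℂ F (ball 0 1)) {r₀ : ℝ} (hr₀ : 0 < r₀)
    (hFB : EqOn F (fun z ↦ ∑' i, term (c i) (u i) z) (ball 0 r₀)) {p : ℂ} {R : ℝ} (hR : 0 < R)
    (hRp : ‖p‖ + R < 1) {V : Set ℂ} (hV : IsPreconnected V) (hV0 : (0 : ℂ) ∈ V)
    (hVsub : V ⊆ ball 0 1 \ closure (poleSet u)) (hSV : sphere p R ⊆ V) :
    ∑' i, discWeight (c i) (u i) p R = 0 := by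
  have hzr : ∀ z ∈ sphere p R, ‖z‖ ≤ ‖p‖ + R := fun z hz ↦ by
    rw [mem_sphere, dist_eq_norm] at hz
    calc ‖z‖ = ‖p + (z - p)‖ := by congr 1; ring
      _ ≤ ‖p‖ + ‖z - p‖ := norm_add_le _ _
      _ = ‖p‖ + R := by rw [hz]
  have hcb : closedBall p R ⊆ ball (0 : ℂ) 1 := fun z hz ↦ by
    rw [mem_closedBall, dist_eq_norm] at hz
    rw [mem_ball_zero_iff]
    calc ‖z‖ = ‖p + (z - p)‖ := by congr 1; ring
      _ ≤ ‖p‖ + ‖z - p‖ := norm_add_le _ _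
      _ < 1 := by linarith
  -- separation of the circle from the pole set
  have hdisj : Disjoint (sphere p R) (closure (poleSet u)) :=
    Set.disjoint_left.2 fun z hz hzcl ↦ (hVsub (hSV hz)).2 hzcl
  obtain ⟨δ₁, hδ₁, hsep⟩ := exists_separation (isCompact_sphere p R) hdisj
  set δ : ℝ := min δ₁ (1 - (‖p‖ + R)) with hδ
  have hδ0 : 0 < δ := lt_min hδ₁ (by linarith)
  have hδr : δ ≤ 1 - (‖p‖ + R) := min_le_right _ _
  have hfar : ∀ z ∈ sphere p R, ∀ q ∈ poleSet u, δ ≤ ‖q - z‖ :=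
    fun z hz q hq ↦ (min_le_left _ _).trans (hsep z hz q hq)
  have hoff : ∀ q ∈ poleSet u, q ∉ sphere p R := fun q hq hqs ↦ by
    have := hfar _ hqs q hq
    rw [sub_self, norm_zero] at this
    linarith
  -- `∮ B = ∑' ∮ termᵢ`, `∮ termᵢ = -2πi · discWeightᵢ`
  have hsum := hasSum_circleIntegral_borel hc hu hR hδ0 hδr hzr hfar
  have hterm : ∀ i, (∮ z in C(p, R), term (c i) (u i) z) =
      -(2 * π * I) * discWeight (c i) (u i) p R := by
    intro i
    refine circleIntegral_term (hu i) hR hcb (fun h ↦ ?_) (fun h ↦ ?_)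
    · exact hoff _ ⟨mem_ball_zero_iff.1 (hcb (sphere_subset_closedBall h)), i, Or.inl rfl⟩ h
    · exact hoff _ ⟨mem_ball_zero_iff.1 (hcb (sphere_subset_closedBall h)), i, Or.inr rfl⟩ h
  -- `∮ B = ∮ F = 0` (identity theorem on `V`, Cauchy on the closed disc)
  have hFBV := eqOn_of_preconnected hc hu hF hr₀ hFB hV hV0 hVsub
  have hI0 : (∮ z in C(p, R), ∑' i, term (c i) (u i) z) = 0 := by
    rw [← circleIntegral.integral_congr hR.le (hFBV.mono hSV)]
    exact circleIntegral_eq_zero_of_differentiable_on_off_countable hR.le countable_empty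
      (hF.continuousOn.mono hcb)
      (fun z hz ↦ hF.differentiableAt (isOpen_ball.mem_nhds (hcb (ball_subset_closedBall hz.1))))
  have h2 : HasSum (fun i ↦ -(2 * π * I) * discWeight (c i) (u i) p R) 0 := by
    have h := hsum
    simp_rw [hterm] at h
    rwa [hI0] at h
  have h3 : -(2 * π * I) * ∑' i, discWeight (c i) (u i) p R = 0 := by
    rw [← tsum_mul_left]; exact h2.tsum_eq
  have h2pi : -(2 * π * I : ℂ) ≠ 0 := by
    refine neg_ne_zero.2 (mul_ne_zero (mul_ne_zero two_ne_zero ?_) I_ne_zero)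
    exact_mod_cast Real.pi_ne_zero
  exact (mul_eq_zero.1 h3).resolve_left h2pi

/-! ## 2. Radius `→ 1⁻`: the charge on the unit disc (ζ-free) -/

/-- For `r < 1` beyond the moduli of the inside poles of the term, its charge on `ball 0 r` equals its
charge on the unit disc. -/
theorem discWeight_zero_eq_of_lt {c u : ℂ} {r : ℝ} (hr1 : r < 1)
    (h₁ : ‖u⁻¹‖ < 1 → ‖u⁻¹‖ < r) (h₂ : ‖u‖ < 1 → ‖u‖ < r) :
    discWeight c u 0 r = discWeight c u 0 1 := by
  unfold discWeight
  simp only [sub_zero]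
  congr 1
  · by_cases hq : ‖u⁻¹‖ < 1
    · rw [if_pos hq, if_pos (h₁ hq)]
    · rw [if_neg hq, if_neg fun h ↦ hq (h.trans hr1)]
  · by_cases hq : ‖u‖ < 1
    · rw [if_pos hq, if_pos (h₂ hq)]
    · rw [if_neg hq, if_neg fun h ↦ hq (h.trans hr1)]

/-- Along radii `r_n → 1`, `r_n < 1`, the charge of one term on `ball 0 r_n` is eventually its charge
on the unit disc. -/
theorem eventually_discWeight_zero_eq (c u : ℂ) {r : ℕ → ℝ} (hr1 : ∀ n, r n < 1)
    (hr : Tendsto r atTop (𝓝 1)) :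
    ∀ᶠ n in atTop, discWeight c u 0 (r n) = discWeight c u 0 1 := by
  have e₁ : ∀ᶠ n in atTop, ‖u⁻¹‖ < 1 → ‖u⁻¹‖ < r n := by
    by_cases hq : ‖u⁻¹‖ < 1
    · exact ((tendsto_order.1 hr).1 _ hq).mono fun n hn _ ↦ hn
    · exact Eventually.of_forall fun n h ↦ absurd h hq
  have e₂ : ∀ᶠ n in atTop, ‖u‖ < 1 → ‖u‖ < r n := by
    by_cases hq : ‖u‖ < 1
    · exact ((tendsto_order.1 hr).1 _ hq).mono fun n hn _ ↦ hn
    · exact Eventually.of_forall fun n h ↦ absurd h hq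
  filter_upwards [e₁, e₂] with n h1 h2
  exact discWeight_zero_eq_of_lt (hr1 n) h1 h2

/-- **Radius `→ 1⁻` (ζ-free, Tannery).**  If for every `δ > 0` some radius `r ∈ (1 - δ, 1)` has
`∑' i, discWeight (c i) (u i) 0 r = 0`, then `∑' i, discWeight (c i) (u i) 0 1 = 0`. -/
theorem tsum_discWeight_zero_one_eq_zero {ι : Type*} {c u : ι → ℂ} (hc : Summable fun i ↦ ‖c i‖)
    (hrad : ∀ δ : ℝ, 0 < δ → ∃ r ∈ Set.Ioo (1 - δ) 1, ∑' i, discWeight (c i) (u i) 0 r = 0) :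
    ∑' i, discWeight (c i) (u i) 0 1 = 0 := by
  choose r hr hzero using fun n : ℕ ↦ hrad (1 / ((n : ℝ) + 1)) (by positivity)
  have hr1 : ∀ n, r n < 1 := fun n ↦ (hr n).2
  have hrlim : Tendsto r atTop (𝓝 1) := by
    have h1 : Tendsto (fun n : ℕ ↦ (1 : ℝ) - 1 / ((n : ℝ) + 1)) atTop (𝓝 (1 - 0)) :=
      tendsto_const_nhds.sub (tendsto_one_div_add_atTop_nhds_zero_nat (𝕜 := ℝ))
    rw [sub_zero] at h1
    exact tendsto_of_tendsto_of_tendsto_of_le_of_le h1 tendsto_const_nhds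
      (fun n ↦ (hr n).1.le) (fun n ↦ (hr1 n).le)
  have hlim : Tendsto (fun n ↦ ∑' i, discWeight (c i) (u i) 0 (r n)) atTop
      (𝓝 (∑' i, discWeight (c i) (u i) 0 1)) := by
    refine tendsto_tsum_of_dominated_convergence (bound := fun i ↦ ‖c i‖) hc (fun i ↦ ?_) ?_
    · exact tendsto_const_nhds.congr'
        ((eventually_discWeight_zero_eq (c i) (u i) hr1 hrlim).mono fun n h ↦ h.symm)
    · refine Eventually.of_forall fun n i ↦ norm_discWeight_le fun z hz ↦ ?_
      exact mem_ball_zero_iff.2 ((mem_ball_zero_iff.1 hz).trans (hr1 n))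
  have hconst : (fun n ↦ ∑' i, discWeight (c i) (u i) 0 (r n)) = fun _ ↦ (0 : ℂ) := funext hzero
  rw [hconst] at hlim
  exact tendsto_nhds_unique hlim tendsto_const_nhds

/-! ## 3. The ζ-side: origin-circle flux and LASSO FLUX -/

/-- **Origin-circle flux** (`h > 0`, RH-free).  Under `CEIL(h)`, every circle `|z| = r` (`r < 1`)
contained in the component `Ω₀` of `0` in `𝔻 ∖ T_h` encloses total aliased charge zero:
`∑_ρ discWeight (c_ρ) (u_ρ) 0 r = 0`. -/
theorem tsum_discWeight_origin_eq_zero_of_latticeCeiling {h : ℝ} (hh : 0 < h)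
    (hceil : LatticeCeiling h) {r : ℝ} (hr1 : r < 1)
    (hS : sphere (0 : ℂ) r ⊆
      connectedComponentIn (ball (0 : ℂ) 1 \ closure (aliasedPoleSet h)) 0) :
    ∑' ρ : ZetaZeros.riemannZetaNontrivialZeros, discWeight (coeff ρ) (mult h ρ) 0 r = 0 := by
  rcases le_or_gt r 0 with hr0 | hr0
  · -- no pole has norm `< r ≤ 0`
    have hzero : ∀ ρ : ZetaZeros.riemannZetaNontrivialZeros,
        discWeight (coeff ρ) (mult h ρ) 0 r = 0 := by
      intro ρ
      have h1 : ¬ ‖(mult h ρ)⁻¹ - 0‖ < r := fun h' ↦ not_lt.2 (norm_nonneg _) (h'.trans_le hr0)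
      have h2 : ¬ ‖mult h ρ - 0‖ < r := fun h' ↦ not_lt.2 (norm_nonneg _) (h'.trans_le hr0)
      unfold discWeight
      rw [if_neg h1, if_neg h2, add_zero]
    simp only [hzero, tsum_zero]
  · haveI : Countable ZetaZeros.riemannZetaNontrivialZeros :=
      countable_of_summable_of_re_neg summable_norm_coeff re_coeff_neg
    exact tsum_discWeight_eq_zero_of_lt_one (c := coeff) (u := mult h)
      (V := connectedComponentIn (ball (0 : ℂ) 1 \ closure (aliasedPoleSet h)) 0)
      summable_norm_coeff (mult_ne_zero h) (differentiableOn_latticeGF hceil)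
      (Real.exp_pos (-(h / 2))) (fun _ hz ↦ latticeGF_eq_borel hh (mem_ball_zero_iff.1 hz)) hr0
      (by rwa [norm_zero, zero_add]) isPreconnected_connectedComponentIn
      (mem_connectedComponentIn (zero_mem_ball_diff_closure hh.le)) (connectedComponentIn_subset _ _)
      hS

/-- **LASSO FLUX** (`h > 0`, RH-free) — the statement of `Theses.ScrewLasso.LassoFlux`.  Under `CEIL(h)`:
if for every `δ > 0` some circle `|z| = r`, `r ∈ (1 - δ, 1)`, lies in the component `Ω₀` of `0` in
`𝔻 ∖ T_h`, then the total aliased charge vanishes: `∑_ρ discWeight (c_ρ) (u_ρ) 0 1 = 0`. -/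
theorem lassoFlux_of_latticeCeiling {h : ℝ} (hh : 0 < h) (hceil : LatticeCeiling h)
    (hlasso : ∀ δ : ℝ, 0 < δ → ∃ r ∈ Set.Ioo (1 - δ) 1,
      sphere (0 : ℂ) r ⊆ connectedComponentIn (ball (0 : ℂ) 1 \ closure (aliasedPoleSet h)) 0) :
    ∑' ρ : ZetaZeros.riemannZetaNontrivialZeros, discWeight (coeff ρ) (mult h ρ) 0 1 = 0 :=
  tsum_discWeight_zero_one_eq_zero (c := coeff) (u := mult h) summable_norm_coeff fun δ hδ ↦ by
    obtain ⟨r, hr, hS⟩ := hlasso δ hδ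
    exact ⟨r, hr, tsum_discWeight_origin_eq_zero_of_latticeCeiling hh hceil hr.2 hS⟩

end Summit.RiemannHypothesis.RiemannHypothesis.Theorems.Splittings.ScrewLassoFlux
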